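import Summits.AnomalousDissipation.AnomalousDissipation.Theses.MirrorVariety
import Summits.AnomalousDissipation.AnomalousDissipation.Theorems.TaylorGreenLoudGalerkinStates.Negative.Anatomy
import Summits.AnomalousDissipation.AnomalousDissipation.Theorems.MirrorVarietyTaylorGreenLoudGalerkinStatesStubTgForceRegular

/-!
# Skeleton of the line `Sketch` (card `half-turn-parity-forcing`) — crux stmt-AnomalousDissipation-15060,
`MirrorVariety.TaylorGreenLogLoudStates`; line lead prover-line-stmt-AnomalousDissipation-15060-0 (v2)

Owned copy of the planner's `SketchHalfTurnParity.lean` (ideator 1, round 1), reshaped into REGISTERED STUBS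
(`stub_divIdentityBox`, `stub_signedCountIdOutside`, `stub_coerciveCutoff` — the three analytic-degree statements
the lever reduces to, all provable from tree material; `stub_census`; `stub_heart`) and the
composition `TaylorGreenLogLoudStates_of` which concludes the crux BY NAME.  Composition: D1a + D1b + D2 ⇒
`CoerciveSignedCount` (`coerciveSignedCount_of`) ⇒ the ℤ₂-twisted lever `TwistedDegreeForcesBrokenZeros`
(`twistedDegree_of_coerciveSignedCount`); lever + `stub_census` ⇒ M1 `HBrokenSteadyStatesExist` (non-laminar
`H`-broken `K`-symmetric steady Taylor–Green Galerkin states, `hBroken_of_census`); `stub_heart` ⇒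
`HBrokenLogLoudStates` ⇒ crux (`crux_of_hBrokenLogLoud`).

First checkable statements of the line, typed over existing declarations:

* `TwistedDegreeForcesBrokenZeros` — the abstract finite-dimensional lever (Brouwer degree; TRUE in print,
  not yet in tree: Mathlib has no degree theory, the tree has Brouwer's fixed point theorem only):
  a coercive C¹ self-map of a Euclidean space whose zeros inside a linear involution's fixed space are
  nondegenerate with signed Jacobian count ≠ 1 has a zero OUTSIDE the fixed space.
* `halfTurn`, `IsHSymm` — the half-turn `H : x ↦ (½ − x₀, x₁, ½ − x₂)` of the Taylor–Green cell (a proper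
  rotation by π about the horizontal line `{x₀ = ¼, x₂ = ¼}`, a symmetry of `f_TG` exchanging the two
  counter-swirling layers `x₂ < ¼`, `x₂ > ¼`; the von Kármán `R_π`).
* `HBrokenSteadyStatesExist` — milestone M1 of the line (rigorous existence of NON-LAMINAR steady
  Taylor–Green Galerkin states along `ν_j → 0⁺`: `K`-symmetric, `H`-broken).
* `HBrokenLogLoudStates` — the heart (the crux witnessed inside the `H`-broken class) and the one-line
  glue `crux_of_hBrokenLogLoud` (the line concludes the crux BY NAME).
-/

noncomputable section

set_option linter.dupNamespace false

open scoped InnerProductSpace Topology BigOperators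
open MeasureTheory Filter
open Literature.Analysis.FunctionSpaces Literature.Analysis.FunctionSpaces.Torus
open Summit.AnomalousDissipation.AnomalousDissipation.Theorems.TaylorGreenLoudGalerkinStates.Negative
open Summit.AnomalousDissipation.AnomalousDissipation.Theorems.TaylorGreenLoudGalerkinStates (reflMat actVec IsKSymm)

namespace Summit.AnomalousDissipation.AnomalousDissipation.Cruxes.TaylorGreenLogLoudStates.HalfTurnLine

/-! ## §1 The abstract lever: a ℤ₂-twisted degree count forces symmetry-broken zeros -/

/-- **Twisted degree forces broken zeros** (Brouwer degree; e.g. Krasnosel'skiĭ–Zabreĭko 1984 §§1–3,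
Rabinowitz 1971 for the continuum version).  Let `F` be a `C¹` self-map of `ℝⁿ` which is COERCIVE
(`⟪F c, c⟫ > 0` outside a ball, so `deg(F, B_R, 0) = deg(id) = 1`) and `H` a linear involution.  If the zeros
of `F` lying in `Fix H` form a finite set `S` of NONDEGENERATE zeros whose signed Jacobian count
`∑_{c ∈ S} sign det DF(c)` is different from `1`, then `F` has a zero OUTSIDE `Fix H`.
(For `H`-equivariant `F`, `DF(c)` at `c ∈ Fix H` is block-diagonal on the `±1`-eigenspaces of `H` and
`sign det DF(c) = sign det DF(c)|₊ · sign det DF(c)|₋`: the count changes exactly when an `H`-ODD real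
eigenvalue crosses zero on a symmetric branch — a pitchfork.)  Not provable in tree today (no degree
theory in Mathlib); stated as the line's imported lever. -/
def TwistedDegreeForcesBrokenZeros : Prop :=
  ∀ (n : ℕ) (F : EuclideanSpace ℝ (Fin n) → EuclideanSpace ℝ (Fin n))
    (H : EuclideanSpace ℝ (Fin n) →L[ℝ] EuclideanSpace ℝ (Fin n)) (S : Finset (EuclideanSpace ℝ (Fin n))),
    (∀ c, H (H c) = c) → ContDiff ℝ 1 F →
    (∃ R : ℝ, 0 < R ∧ ∀ c, R ≤ ‖c‖ → 0 < ⟪F c, c⟫_ℝ) →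
    (∀ c, c ∈ S ↔ (F c = 0 ∧ H c = c)) →
    (∀ c ∈ S, (fderiv ℝ F c).det ≠ 0) →
    (∑ c ∈ S, Real.sign ((fderiv ℝ F c).det)) ≠ 1 →
    ∃ c, F c = 0 ∧ H c ≠ c

/-! ### §1b Reduction of the lever to three analytic-degree statements provable from tree material

The tree holds the analytic (Heinz–Nagumo / Chang 2005 §3.1) core of the Brouwer degree:
`Literature.Analysis.Calculus.setIntegral_comp_mul_det_eq_integral_mul_sum_sign` (local degree formula at
nondegenerate zeros), `sum_fderiv_piolaField` (null-Lagrangian identity), `integral_divG_comp_mul_det_eq_zero`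
(its periodic, mollified form), `Literature.Topology.Euclidean.exists_field_with_bump_divergence` and the torus
index theorem `sum_sign_det_eq_zero_of_periodic`.  The coercive normalisation `∑ sign det = 1`
(Krasnosel'skiĭ–Zabreĭko 1984, Thm 4.3 + Thm 6.3 + §3 Property 3 with the Poincaré–Bohl Thm 2.1) is NOT in the
tree; it follows from the three statements below (D1a, D1b, D2), each provable now, and implies the lever. -/

/-- **D1a — the degree integrand integrates to zero against a divergence whose pull-back vanishes near the
boundary of a box** (the non-periodic twin of `Literature.Analysis.Calculus.integral_divG_comp_mul_det_eq_zero`;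
Chang 2005 Lemma 3.1.3 / Thm 3.1.4 with the boundary term killed by a support condition): for `C¹`
`f : ℝⁿ⁺¹ → ℝⁿ⁺¹`, a box `K = [a, b]`, a compactly supported differentiable `G` with continuous divergence `ψ`,
if `f` maps the boundary of `K` (the closed box minus the open box) outside `tsupport G`, then
`∫_K ψ(f x) · det Df(x) dx = 0`. -/
def DivIdentityBox : Prop :=
  ∀ (n : ℕ) (a b : Fin (n + 1) → ℝ) (f G : (Fin (n + 1) → ℝ) → Fin (n + 1) → ℝ) (ψ : (Fin (n + 1) → ℝ) → ℝ),
    a ≤ b → ContDiff ℝ 1 f → Differentiable ℝ G → Continuous ψ →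
    (∀ v, ∑ i, fderiv ℝ G v (Pi.single i 1) i = ψ v) → HasCompactSupport G →
    (∀ x ∈ Set.Icc a b, x ∉ Set.pi Set.univ (fun i => Set.Ioo (a i) (b i)) → f x ∉ tsupport G) →
    ∫ x in Set.Icc a b, ψ (f x) * (fderiv ℝ f x).det = 0

/-- **D1b — signed zero count of a `C¹` field equal to the identity outside a ball** (Brouwer degree
normalisation `deg(id) = 1` in the regular-value form; Krasnosel'skiĭ–Zabreĭko 1984 Thm 4.3 + Thm 6.3 + Property 3;
Chang 2005 §3.1 (3.4)–(3.5)): if `G : ℝⁿ → ℝⁿ` is `C¹`, `G c = c` for `‖c‖ ≥ R`, and its zero set is the finite set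
`S` of nondegenerate zeros, then `∑_{c ∈ S} sign det DG(c) = 1`.  (Proof route with D1a: shift the value `0` to a
far value `y₀ = R' e₀` at which `G = id` has the single preimage `y₀`, comparing the two local degree formulas through
`exists_field_with_bump_divergence`.) -/
def SignedCountIdOutside : Prop :=
  ∀ (n : ℕ) (G : EuclideanSpace ℝ (Fin n) → EuclideanSpace ℝ (Fin n)) (R : ℝ) (S : Finset (EuclideanSpace ℝ (Fin n))),
    0 < R → ContDiff ℝ 1 G → (∀ c, R ≤ ‖c‖ → G c = c) → (∀ c, c ∈ S ↔ G c = 0) →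
    (∀ c ∈ S, (fderiv ℝ G c).det ≠ 0) →
    ∑ c ∈ S, Real.sign ((fderiv ℝ G c).det) = 1

/-- **D2 — coercive cut-off to the identity**: a `C¹` field with `⟪F c, c⟫ > 0` for `‖c‖ ≥ R > 0` agrees on the
closed ball `‖c‖ ≤ R` with a `C¹` field `G` which is the identity for `‖c‖ ≥ R + 1` and still satisfies
`⟪G c, c⟫ > 0` for `‖c‖ ≥ R` (`G = b·F + (1 − b)·id` with a smooth bump `b`, `b = 1` on the ball, `b = 0` outside
`R + 1`; a pointwise convex combination — no homotopy argument). -/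
def CoerciveCutoff : Prop :=
  ∀ (n : ℕ) (F : EuclideanSpace ℝ (Fin n) → EuclideanSpace ℝ (Fin n)) (R : ℝ), 0 < R → ContDiff ℝ 1 F →
    (∀ c, R ≤ ‖c‖ → 0 < ⟪F c, c⟫_ℝ) →
    ∃ G : EuclideanSpace ℝ (Fin n) → EuclideanSpace ℝ (Fin n), ContDiff ℝ 1 G ∧
      (∀ c, ‖c‖ ≤ R → G c = F c) ∧ (∀ c, R + 1 ≤ ‖c‖ → G c = c) ∧ (∀ c, R ≤ ‖c‖ → 0 < ⟪G c, c⟫_ℝ)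

/-- **Coercive signed zero count** (Kronecker / Brouwer; Krasnosel'skiĭ–Zabreĭko 1984, Ch. 1: Thm 2.1
(Poincaré–Bohl) + §3 Property 3 + Thm 4.3 (algebraic count of singular points) + Thm 6.3 (index of a nondegenerate
zero `= sign det`)): a `C¹` field on `ℝⁿ` with `⟪F c, c⟫ > 0` for `‖c‖ ≥ R` whose zero set is the finite set `S`
of nondegenerate zeros has `∑_{c ∈ S} sign det DF(c) = 1`. -/
def CoerciveSignedCount : Prop :=
  ∀ (n : ℕ) (F : EuclideanSpace ℝ (Fin n) → EuclideanSpace ℝ (Fin n)) (S : Finset (EuclideanSpace ℝ (Fin n))),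
    ContDiff ℝ 1 F → (∃ R : ℝ, 0 < R ∧ ∀ c, R ≤ ‖c‖ → 0 < ⟪F c, c⟫_ℝ) → (∀ c, c ∈ S ↔ F c = 0) →
    (∀ c ∈ S, (fderiv ℝ F c).det ≠ 0) →
    ∑ c ∈ S, Real.sign ((fderiv ℝ F c).det) = 1

/-- A coercive field has no zero on or outside the coercivity sphere. [folklore] -/
theorem norm_lt_of_eq_zero {n : ℕ} {F : EuclideanSpace ℝ (Fin n) → EuclideanSpace ℝ (Fin n)} {R : ℝ}
    (hco : ∀ c, R ≤ ‖c‖ → 0 < ⟪F c, c⟫_ℝ) {c : EuclideanSpace ℝ (Fin n)} (hc : F c = 0) : ‖c‖ < R := by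
  by_contra h
  have h1 := hco c (not_lt.1 h)
  rw [hc, inner_zero_left] at h1
  exact lt_irrefl _ h1

/-- **D1b + D2 ⇒ the coercive signed zero count** (kernel-checked reduction): cut `F` off to the identity outside
`R + 1` without creating zeros; the zero set and the Jacobians at the zeros are unchanged. [folklore] -/
theorem coerciveSignedCount_of (h1 : SignedCountIdOutside) (h2 : CoerciveCutoff) : CoerciveSignedCount := by
  intro n F S hF hR hS hnd
  obtain ⟨R, hR0, hco⟩ := hR
  obtain ⟨G, hG, hGF, hGid, hGco⟩ := h2 n F R hR0 hF hco
  have hSG : ∀ c, c ∈ S ↔ G c = 0 := fun c => by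
    rw [hS]
    constructor
    · intro h
      rw [hGF c (norm_lt_of_eq_zero hco h).le]
      exact h
    · intro h
      rw [← hGF c (norm_lt_of_eq_zero hGco h).le]
      exact h
  have hfd : ∀ c ∈ S, fderiv ℝ G c = fderiv ℝ F c := fun c hc => by
    refine Filter.EventuallyEq.fderiv_eq ?_
    have hlt : ‖c‖ < R := norm_lt_of_eq_zero hco ((hS c).1 hc)
    filter_upwards [Metric.isOpen_ball.mem_nhds (mem_ball_zero_iff.2 hlt)] with y hy
    exact hGF y (mem_ball_zero_iff.1 hy).le
  have key := h1 n G (R + 1) S (by linarith) hG hGid hSG (fun c hc => by rw [hfd c hc]; exact hnd c hc)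
  rw [← key]
  exact Finset.sum_congr rfl fun c hc => by rw [hfd c hc]

/-- **The coercive signed count implies the lever** (pure logic: if every zero of `F` were `H`-fixed, the zero set
would be `S` and its signed count would be `1`). [folklore] -/
theorem twistedDegree_of_coerciveSignedCount (h : CoerciveSignedCount) : TwistedDegreeForcesBrokenZeros := by
  intro n F H S _hH hF hco hS hnd hsum
  by_contra hcon
  push Not at hcon
  refine hsum (h n F S hF hco (fun c => ?_) hnd)
  rw [hS c]
  exact ⟨fun hc => hc.1, fun hc => ⟨hc, hcon c hc⟩⟩

/-! ## §2 The half-turn of the Taylor–Green cell -/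

/-- The linear part `diag(−1, 1, −1)` of the half-turn (a proper rotation by `π` about the `x₁`-direction). -/
def halfTurnMat : Matrix (Fin 3) (Fin 3) ℤ :=
  Matrix.diagonal ![-1, 1, -1]

/-- The shift `(½, 0, ½)` of the half-turn. -/
def halfTurnShift : UnitAddTorus (Fin 3) :=
  fun i => if i = 1 then 0 else (((1 / 2 : ℝ)) : UnitAddCircle)

/-- The half-turn `H x = (½ − x₀, x₁, ½ − x₂)`: rotation by `π` about the line `{x₀ = ¼, x₂ = ¼}` through the
cell centre `J = (¼,¼,¼)`; `f_TG ∘ H = diag(−1,1,−1) · f_TG` (checked symbolically in TRIAGE-r1-1 (V) for the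
sibling card and numerically in this session's kit job). -/
def halfTurn (x : UnitAddTorus (Fin 3)) : UnitAddTorus (Fin 3) :=
  Torus.mulVecT halfTurnMat x + halfTurnShift

/-- `H`-symmetry of a vector field: `u (H x) = diag(−1,1,−1) · u x`.  In `Fix H` the vertical vorticity and
the vertical velocity vanish at the cell centre `J` (and on the whole horizontal line through it):
`ω₂(J) = u₂(J) = 0` — the obstruction that forced `Φ(p) = 0` ropes in round 1 (triage r1-2 N3). -/
def IsHSymm (u : UnitAddTorus (Fin 3) → EuclideanSpace ℝ (Fin 3)) : Prop :=
  ∀ x, u (halfTurn x) = actVec halfTurnMat (u x)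

/-! ## §3 Milestone M1: non-laminar (half-turn–broken) steady Taylor–Green states exist along `ν_j → 0⁺` -/

/-- **M1 (rigorous non-laminar existence).**  Along some `ν_j → 0⁺`, for every `j` and all large `N`, there is an
admissible Galerkin steady Taylor–Green state which is `K`-symmetric but NOT `H`-symmetric.  (The laminar
cell state has every symmetry of `f_TG`, so such a state is off the laminar branch.)  Obtained from
`TwistedDegreeForcesBrokenZeros` + the spectral parity of the symmetric branch (card, K2). -/
def HBrokenSteadyStatesExist : Prop :=
  ∃ ν : ℕ → ℝ, (∀ j, 0 < ν j) ∧ Tendsto ν atTop (𝓝 0) ∧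
    ∀ j, ∀ᶠ N in atTop, ∃ U : UnitAddTorus (Fin 3) → EuclideanSpace ℝ (Fin 3),
      IsSteadyState (ν j) N tgForce U ∧ IsKSymm U ∧ ¬ IsHSymm U

/-- **The census hypothesis (TG instantiation of the lever), abstract coordinates.**  Along `ν`, for every `j` and all large `N`
there are: a Euclidean coordinate space `ℝⁿ` (the `K ∩ C₄`-symmetric admissible Galerkin states at resolution `N`), the steady
Galerkin map `F` in these coordinates with the half-turn `H` acting linearly, the finite set `S` of `H`-symmetric zeros — satisfying
the hypotheses of `TwistedDegreeForcesBrokenZeros` INCLUDING the parity clause `∑ sign det ≠ 1` — and a realisation map `e` sending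
zeros of `F` to `K`-symmetric admissible steady Taylor–Green states at `(ν j, N)` under which `H`-symmetry of the field forces `H c = c`.
This is the line's stub `LaminarHalfTurnParity` in honest (global-census) form; see the card, residual (5a). -/
def GalerkinParityCensus (ν : ℕ → ℝ) : Prop :=
  ∀ j, ∀ᶠ N in atTop, ∃ (n : ℕ) (F : EuclideanSpace ℝ (Fin n) → EuclideanSpace ℝ (Fin n))
    (H : EuclideanSpace ℝ (Fin n) →L[ℝ] EuclideanSpace ℝ (Fin n)) (S : Finset (EuclideanSpace ℝ (Fin n)))
    (e : EuclideanSpace ℝ (Fin n) → UnitAddTorus (Fin 3) → EuclideanSpace ℝ (Fin 3)),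
    (∀ c, H (H c) = c) ∧ ContDiff ℝ 1 F ∧
    (∃ R : ℝ, 0 < R ∧ ∀ c, R ≤ ‖c‖ → 0 < ⟪F c, c⟫_ℝ) ∧
    (∀ c, c ∈ S ↔ (F c = 0 ∧ H c = c)) ∧
    (∀ c ∈ S, (fderiv ℝ F c).det ≠ 0) ∧
    (∑ c ∈ S, Real.sign ((fderiv ℝ F c).det)) ≠ 1 ∧
    (∀ c, F c = 0 → IsSteadyState (ν j) N tgForce (e c) ∧ IsKSymm (e c) ∧ (IsHSymm (e c) → H c = c))

/-- **Lever + census ⇒ M1** (kernel-checked composition: the abstract degree fact and the TG parity census give non-laminar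
`H`-broken steady Taylor–Green Galerkin states along `ν`). -/
theorem hBroken_of_census (hlever : TwistedDegreeForcesBrokenZeros) {ν : ℕ → ℝ} (hν : ∀ j, 0 < ν j)
    (hlim : Tendsto ν atTop (𝓝 0)) (hcensus : GalerkinParityCensus ν) : HBrokenSteadyStatesExist := by
  refine ⟨ν, hν, hlim, fun j => ?_⟩
  filter_upwards [hcensus j] with N hN
  obtain ⟨n, F, H, S, e, hHH, hF, hco, hS, hnd, hpar, hreal⟩ := hN
  obtain ⟨c, hc0, hcH⟩ := hlever n F H S hHH hF hco hS hnd hpar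
  obtain ⟨hst, hK, hHsym⟩ := hreal c hc0
  exact ⟨e c, hst, hK, fun h => hcH (hHsym h)⟩

/-! ## §4 The heart and the glue to the crux -/

/-- **Heart of the line.**  The log crux witnessed INSIDE the `H`-broken `K`-symmetric class (the through-flow
column states of the card): log energy, `ν`-independent loudness. -/
def HBrokenLogLoudStates : Prop :=
  ∃ (ν : ℕ → ℝ) (E c : ℝ), (∀ j, 0 < ν j ∧ ν j ≤ 1 / 4) ∧ Tendsto ν atTop (𝓝 0) ∧ 0 < c ∧
    ∀ j, ∀ᶠ N in atTop, ∃ U : UnitAddTorus (Fin 3) → EuclideanSpace ℝ (Fin 3),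
      IsSteadyState (ν j) N tgForce U ∧ IsKSymm U ∧ ¬ IsHSymm U ∧
        ∫ x, ‖U x‖ ^ 2 ≤ E * Real.log (1 / ν j) ∧ c ≤ ν j * gradNormSq U

/-- The heart implies the crux BY NAME (drop the two symmetry conjuncts; `tgForce` is the crux's lambda). -/
theorem crux_of_hBrokenLogLoud (h : HBrokenLogLoudStates) :
    Summit.AnomalousDissipation.AnomalousDissipation.Theses.MirrorVariety.TaylorGreenLogLoudStates := by
  obtain ⟨ν, E, c, hν, hlim, hc, hj⟩ := h
  intro f hf
  subst hf
  refine ⟨ν, E, c, hν, hlim, hc, fun j => ?_⟩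
  filter_upwards [hj j] with N hN
  obtain ⟨U, hU, -, -, hE, hl⟩ := hN
  exact ⟨U, hU, hE, hl⟩

/-! ## §5 Registered stubs and the composition (the only `sorry`s of the file are the `stub_*`)

The three analytic-degree stubs are stated in UNFOLDED, Mathlib-only form (their proofs need no line vocabulary and
land as plain theorems); `DivIdentityBox`, `SignedCountIdOutside`, `CoerciveCutoff` above are the same statements
by name (definitional unfolding). -/

/-- **stub_divIdentityBox** (D1a, = `DivIdentityBox`) — the non-periodic divergence identity for the degree
integrand: `∫_K ψ(f) det Df = 0` when `ψ = div G`, `G` compactly supported, and `f(∂K) ∩ tsupport G = ∅`. -/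
theorem stub_divIdentityBox :
    ∀ (n : ℕ) (a b : Fin (n + 1) → ℝ) (f G : (Fin (n + 1) → ℝ) → Fin (n + 1) → ℝ) (ψ : (Fin (n + 1) → ℝ) → ℝ),
    a ≤ b → ContDiff ℝ 1 f → Differentiable ℝ G → Continuous ψ →
    (∀ v, ∑ i, fderiv ℝ G v (Pi.single i 1) i = ψ v) → HasCompactSupport G →
    (∀ x ∈ Set.Icc a b, x ∉ Set.pi Set.univ (fun i => Set.Ioo (a i) (b i)) → f x ∉ tsupport G) →
    ∫ x in Set.Icc a b, ψ (f x) * (fderiv ℝ f x).det = 0 := by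
  sorry

/-- **stub_signedCountIdOutside** (D1b given D1a, = `DivIdentityBox → SignedCountIdOutside`) — Brouwer degree
normalisation in regular-value form for `C¹` fields equal to the identity outside a ball: `∑ sign det = 1`. -/
theorem stub_signedCountIdOutside :
    (∀ (n : ℕ) (a b : Fin (n + 1) → ℝ) (f G : (Fin (n + 1) → ℝ) → Fin (n + 1) → ℝ) (ψ : (Fin (n + 1) → ℝ) → ℝ),
      a ≤ b → ContDiff ℝ 1 f → Differentiable ℝ G → Continuous ψ →
      (∀ v, ∑ i, fderiv ℝ G v (Pi.single i 1) i = ψ v) → HasCompactSupport G →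
      (∀ x ∈ Set.Icc a b, x ∉ Set.pi Set.univ (fun i => Set.Ioo (a i) (b i)) → f x ∉ tsupport G) →
      ∫ x in Set.Icc a b, ψ (f x) * (fderiv ℝ f x).det = 0) →
    ∀ (n : ℕ) (G : EuclideanSpace ℝ (Fin n) → EuclideanSpace ℝ (Fin n)) (R : ℝ)
      (S : Finset (EuclideanSpace ℝ (Fin n))),
    0 < R → ContDiff ℝ 1 G → (∀ c, R ≤ ‖c‖ → G c = c) → (∀ c, c ∈ S ↔ G c = 0) →
    (∀ c ∈ S, (fderiv ℝ G c).det ≠ 0) →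
    ∑ c ∈ S, Real.sign ((fderiv ℝ G c).det) = 1 := by
  sorry

/-- **stub_coerciveCutoff** (D2, = `CoerciveCutoff`) — a coercive `C¹` field agrees on its coercivity ball with a
`C¹` field equal to the identity outside a larger ball, with no zeros gained. -/
theorem stub_coerciveCutoff :
    ∀ (n : ℕ) (F : EuclideanSpace ℝ (Fin n) → EuclideanSpace ℝ (Fin n)) (R : ℝ), 0 < R → ContDiff ℝ 1 F →
    (∀ c, R ≤ ‖c‖ → 0 < ⟪F c, c⟫_ℝ) →
    ∃ G : EuclideanSpace ℝ (Fin n) → EuclideanSpace ℝ (Fin n), ContDiff ℝ 1 G ∧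
      (∀ c, ‖c‖ ≤ R → G c = F c) ∧ (∀ c, R + 1 ≤ ‖c‖ → G c = c) ∧ (∀ c, R ≤ ‖c‖ → 0 < ⟪G c, c⟫_ℝ) := by
  sorry

/-- **stub_census** — the Taylor–Green parity census: along some `ν_j → 0⁺`, for every `j` and all large `N`, Euclidean
coordinates of the `K`-symmetric Galerkin steady map at `(ν_j, N)` with the half-turn acting as a linear involution, the
map `C¹` and coercive, the finite set of `H`-symmetric zeros nondegenerate with signed Jacobian count `≠ 1`, and a
realisation of coefficient zeros as admissible `K`-symmetric steady Taylor–Green states under which field `H`-symmetry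
forces `H c = c` (card: stub `LaminarHalfTurnParity` in honest global-census form; kit j015675: first real H-odd
crossing of the laminar K-branch extrapolated at `ν_H ≈ 0.004`). -/
theorem stub_census : ∃ ν : ℕ → ℝ, (∀ j, 0 < ν j) ∧ Tendsto ν atTop (𝓝 0) ∧ GalerkinParityCensus ν := by
  sorry

/-- **stub_heart** — the heart of the line: whenever non-laminar `H`-broken `K`-symmetric steady Taylor–Green Galerkin
states exist along some `ν_j → 0⁺` (M1), there is such a family with LOG energy `∫|U|² ≤ E·log(1/ν_j)` and `ν`-independent
loudness `ν_j‖∇U‖² ≥ c > 0` (the through-flow Burgers column on the `C₄` axis carried by the broken branch; card §(3),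
residual (5b); decided first by the F2 numerics). -/
theorem stub_heart : HBrokenSteadyStatesExist → HBrokenLogLoudStates := by
  sorry

/-- **Composition of the line `Sketch` (half-turn parity forcing)** — the registered stubs imply the crux BY NAME:
D1a + D1b + D2 ⇒ coercive signed count (`coerciveSignedCount_of`) ⇒ lever (`twistedDegree_of_coerciveSignedCount`);
lever + census ⇒ M1 (`hBroken_of_census`); heart ⇒ `HBrokenLogLoudStates` ⇒ crux (`crux_of_hBrokenLogLoud`). -/
theorem TaylorGreenLogLoudStates_of :
    Summit.AnomalousDissipation.AnomalousDissipation.Theses.MirrorVariety.TaylorGreenLogLoudStates := by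
  obtain ⟨ν, hν, hlim, hc⟩ := stub_census
  exact crux_of_hBrokenLogLoud (stub_heart (hBroken_of_census
    (twistedDegree_of_coerciveSignedCount
      (coerciveSignedCount_of (stub_signedCountIdOutside stub_divIdentityBox) stub_coerciveCutoff)) hν hlim hc))

end Summit.AnomalousDissipation.AnomalousDissipation.Cruxes.TaylorGreenLogLoudStates.HalfTurnLine

end
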